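import Summits.Ventures.Crystal3D.Theorems.StickyWulffConstantTextureBuildHealWindow
import Summits.Ventures.Crystal3D.Theorems.StickyWulffConstantTextureBuildColumnClean
import HarnessLib

/-!
# TB-1 brick: the CANONICAL COLUMN DEFECT SET `Dfx` as a finite set, and its emptiness on a clean cylinder
# (lane T, crux `TextureLiminfV5`, stmt-Ventures-23912; memo HOME/wulff-p2/g25/SLAB-PLATES-g25.md §3 (step 1), §7)

HONEST FRAMING. Venture `Summits/Ventures/Crystal3D` (cell `crystal3d-full`), route `route-Ventures-StickyWulffConstant`, helper `--supports` the
law-v5 crux `TextureLiminfV5` (stmt-Ventures-23912).  Finite bookkeeping (census-free, standard axioms) over `finite_stacking_inter_closedBall` ('…HealWindow') and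
`column_clean` ('…ColumnClean').  No cover is built; F-C1 not moved.

WHY.  `exists_plates_heal` ('…PlatesHeal') / `exists_slab_window` ('…SlabPlates') take, per cell column with site set `P ⊆ S`, ANY finite `Dfx ⊇` {vacant `S`-sites
within `< 3` of `P`} ∪ {off-`S` balls within `< 3` of `P`} and charge `12·#Dfx/m`.  This file supplies the canonical (smallest) choice as a `Finset` — finiteness of
the vacant sites near a finite `P` is the only point — and shows it has NO element inside a certified clean cylinder, so clean columns contribute nothing to the bill.

* **`exists_dfx`** — for a Hägg stacking `S = stacking L s σ`, a labelled packing `x` and a finite `P`: a finite `Dfx` whose members are EXACTLY the vacant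
  `S`-sites and the off-`S` balls within `< 3` of `P` (both hypotheses `hDv`, `hDb` of the plate lemmas hold, with equivalence);
* **`dfx_subset_of_clean`** — if every `S`-site of a region `Ω` is a ball and every ball in `Ω` is an `S`-site (the two conclusions of `column_clean` /
  `eq_site_of_complete_ball`), then every member of such a `Dfx` lies OUTSIDE `Ω`.
-/

noncomputable section

namespace Summit.Ventures.Crystal3D.Theorems

open Finset Summit.Ventures.Crystal3D
open Literature.MathematicalPhysics.StatisticalMechanics (IsHaggSeq)
open Summit.Ventures.Crystal3D.Cruxes.TextureLiminf.TexShadow (E3 stacking)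

variable {N : ℕ}

open scoped Classical in
/-- **THE CANONICAL COLUMN DEFECT SET.**  For a finite `P`, the vacant sites of the Hägg stacking `S` and the off-`S` balls of `x` within `< 3` of `P` form a finite
set `Dfx`. -/
theorem exists_dfx (x : Fin N → E3) {L : E3 ≃ₗᵢ[ℝ] E3} {s : E3} {σ : ℤ → ℤ} (hσ : IsHaggSeq σ) (P : Finset E3) :
    ∃ Dfx : Finset E3, ∀ d, d ∈ Dfx ↔
      (∃ p ∈ P, dist d p < 3) ∧ ((d ∈ stacking L s σ ∧ d ∉ Set.range x) ∨ (d ∈ Set.range x ∧ d ∉ stacking L s σ)) := by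
  classical
  -- the vacant sites near `P`: inside the finite set of sites within `3` of some point of `P`
  have hfin : ∀ p : E3, (stacking L s σ ∩ Metric.closedBall p 3).Finite := fun p => finite_stacking_inter_closedBall hσ p 3
  let T : Finset E3 := P.biUnion fun p => (hfin p).toFinset
  let A : Finset E3 := T.filter fun d => (∃ p ∈ P, dist d p < 3) ∧ d ∉ Set.range x
  let Bx : Finset E3 := (Finset.univ.image x).filter fun d => (∃ p ∈ P, dist d p < 3) ∧ d ∉ stacking L s σ
  refine ⟨A ∪ Bx, fun d => ?_⟩
  simp only [A, Bx, T, Finset.mem_union, Finset.mem_filter, Finset.mem_biUnion, Set.Finite.mem_toFinset, Set.mem_inter_iff,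
    Metric.mem_closedBall, mem_image_univ_iff_mem_range]
  constructor
  · rintro (⟨⟨p, hp, hdS, hdp⟩, hnear, hvac⟩ | ⟨hdx, hnear, hdS⟩)
    · exact ⟨hnear, Or.inl ⟨hdS, hvac⟩⟩
    · exact ⟨hnear, Or.inr ⟨hdx, hdS⟩⟩
  · rintro ⟨hnear, ⟨hdS, hvac⟩ | ⟨hdx, hdS⟩⟩
    · obtain ⟨p, hp, hdp⟩ := hnear
      exact Or.inl ⟨⟨p, hp, hdS, hdp.le⟩, ⟨p, hp, hdp⟩, hvac⟩
    · exact Or.inr ⟨hdx, hnear, hdS⟩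

/-- The canonical `Dfx` satisfies the hypothesis `hDv` of the plate lemmas. -/
theorem dfx_hDv {x : Fin N → E3} {S : Set E3} {P Dfx : Finset E3}
    (hD : ∀ d, d ∈ Dfx ↔ (∃ p ∈ P, dist d p < 3) ∧ ((d ∈ S ∧ d ∉ Set.range x) ∨ (d ∈ Set.range x ∧ d ∉ S))) :
    ∀ w, w ∈ S → w ∉ Set.range x → (∃ p ∈ P, dist w p < 3) → w ∈ Dfx :=
  fun w hwS hwx hnear => (hD w).2 ⟨hnear, Or.inl ⟨hwS, hwx⟩⟩

/-- The canonical `Dfx` satisfies the hypothesis `hDb` of the plate lemmas. -/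
theorem dfx_hDb {x : Fin N → E3} {S : Set E3} {P Dfx : Finset E3}
    (hD : ∀ d, d ∈ Dfx ↔ (∃ p ∈ P, dist d p < 3) ∧ ((d ∈ S ∧ d ∉ Set.range x) ∨ (d ∈ Set.range x ∧ d ∉ S))) :
    ∀ b, b ∈ Set.range x → b ∉ S → (∃ p ∈ P, dist b p < 3) → b ∈ Dfx :=
  fun b hbx hbS hnear => (hD b).2 ⟨hnear, Or.inr ⟨hbx, hbS⟩⟩

/-- **A CLEAN REGION CARRIES NO DEFECT.**  If in the region `Ω` every `S`-site is a ball and every ball is an `S`-site, no member of a canonical `Dfx` lies in `Ω`. -/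
theorem dfx_subset_of_clean {x : Fin N → E3} {S Ω : Set E3} {P Dfx : Finset E3}
    (hD : ∀ d, d ∈ Dfx ↔ (∃ p ∈ P, dist d p < 3) ∧ ((d ∈ S ∧ d ∉ Set.range x) ∨ (d ∈ Set.range x ∧ d ∉ S)))
    (hsite : ∀ w ∈ S, w ∈ Ω → w ∈ Set.range x) (hball : ∀ c : Fin N, x c ∈ Ω → x c ∈ S) :
    ∀ d ∈ Dfx, d ∉ Ω := by
  intro d hd hdΩ
  rcases ((hD d).1 hd).2 with ⟨hdS, hvac⟩ | ⟨⟨c, rfl⟩, hdS⟩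
  · exact hvac (hsite d hdS hdΩ)
  · exact hdS (hball c hdΩ)

/-- Hence the members of a canonical `Dfx` inside a clean region number zero: `#(Dfx ∩ Ω) = 0` in the filter form used by the pigeonholes. -/
theorem card_dfx_filter_clean_eq_zero {x : Fin N → E3} {S Ω : Set E3} {P Dfx : Finset E3} [DecidablePred (· ∈ Ω)]
    (hD : ∀ d, d ∈ Dfx ↔ (∃ p ∈ P, dist d p < 3) ∧ ((d ∈ S ∧ d ∉ Set.range x) ∨ (d ∈ Set.range x ∧ d ∉ S)))
    (hsite : ∀ w ∈ S, w ∈ Ω → w ∈ Set.range x) (hball : ∀ c : Fin N, x c ∈ Ω → x c ∈ S) :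
    (Dfx.filter fun d => d ∈ Ω).card = 0 := by
  rw [Finset.card_eq_zero, Finset.filter_eq_empty_iff]
  exact fun d hd hdΩ => dfx_subset_of_clean hD hsite hball d hd hdΩ

end Summit.Ventures.Crystal3D.Theorems

end
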